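import Literature.Analysis.Calculus.BCHProductLowOrder
import Literature.Analysis.Complex.RungeUnits
import Literature.MathematicalPhysics.QuantumFieldTheory.Balaban1983to89.BlockAveragingEMLProp2
import HarnessLib

/-!
# N07 [B11] — (G1) of the (L1″) bridge: the `exp[mean log]` of a product family whose LEFT factor is exactly log-centred in the inner index
# equals the `exp[mean log]` of the right factors up to THIRD order

Cell `pub-ymgap`, seat `pub-ymgap-dag-n07-e` g28 (LANE OWNER of the K0 road chart side), work file for ⚑ LOCATED-NRM-ROW-CURRENCY option ρ3 (desk memo
`WORD-NRM-ROW-CURRENCY.md` §5–§6).  GENERIC ALGEBRA in a complete normed `ℂ`-algebra; no lattice object enters.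

WHY.  UST's block frame `vframeU` ([3] (110)) is the JOINT `eml` over `offsets × stair orders` of the raw centre stairs, print's (78)∕(97) frame is the block `exp[mean log]`
over offsets of the (0.11) AVERAGED contour variables `F_r = M({W_{rσ}}_σ)`; Federbush's (0.10) (`BlockAveragingFederbush.sum_mlog_mul_star_fedM`) makes the relative family
`P̃_{rσ} = W_{rσ}F_r⁻¹` EXACTLY log-centred, `Σ_σ log P̃_{rσ} = 0`.  This file proves the consequence: every Baker–Campbell–Hausdorff word LINEAR in `log P̃` dies in the
σ-mean (`½[·,·]` and `(1∕12)[Y,[Y,·]]` included), so `eml_{(r,σ)}[P̃_{rσ}·T_r]` and `eml_r[T_r]` differ by the `(1∕12)[P̃,[P̃,T]]` words and the fourth-order tail only.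

WHAT IS PROVED (`p, t ≤ 1∕24`; `‖P r s − 1‖ ≤ p`, `‖T r − 1‖ ≤ t`, `Σ_s log (P r s) = 0` for every `r`):
* §1 `norm_mlog_mul_sub_bch3_le` — `‖log(P·T) − bch3 (log P) (log T)‖ ≤ 207360·p·(p+t)³` (the tree's `BCHProductLowOrder.norm_logOnePlus_sub_bch3_le_mul_sixth`).
* §2 `sum_bch3_eq_of_centred` — `Σ_s bch3 (log P_s) X = |S|•X + (1∕12)•Σ_s [log P_s,[log P_s, X]]` when `Σ_s log P_s = 0`; `norm_cubic_le`.
* §3 ★ `norm_eml_centred_mul_sub_eml_le` — `‖eml (fun (r,s) ↦ P r s · T r) − eml T‖ ≤ 270000·p·(p+t)³ + 4·p²·t`.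
* §4 (G2) `eml_mul_conj_mul_sub_eml_eq` (exact identity) ∕ `norm_eml_mul_conj_mul_sub_eml_le` — conjugating-frame errors: `‖eml(Y·b·c)·a − eml Y‖ ≤ φ + 64(t+φ)²` (`c·a = 1`):
  coefficient ONE on the block-site error, the centre error only at second order (no growth along the level induction of (L1″)).
* §5 ★★ (G3a) `norm_frameStep_sub_eml_le` — one frame step, algebraic form: `‖a·eml((r,s) ↦ c·P̂_{rs}·Y_r·b_r) − eml Y‖ ≤ φ + 64(t+φ)² + (1+φ)·(G1 at p, 2t+3φ)`.
HONEST SCOPE.  Pure algebra∕analysis (BCH to third order + `exp` Lipschitz); constants are the file's.  Nothing of [3]∕[15]∕[6]∕[I] is proved here; K0⁷ NOT closed; N07 NOT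
discharged; counts unmoved; nothing continuum ∕ OS ∕ Clay.  No `def`, no `instance`, no `sorry`.

References: [Balaban1987RG1] (0.4)–(0.11) p. 253; [Balaban1985Averaging] (78) p. 30, (97) p. 32, (110) p. 34; W. Rossmann, Lie Groups (OUP 2002) §1.3 Thm 1, Problem 2.
-/

set_option autoImplicit false

noncomputable section

open scoped BigOperators
open NormedSpace

namespace Summit.QuantumFields.YangMills.BalabanUVNodes.N07EmlCentredProduct

open Literature.MathematicalPhysics.QuantumFieldTheory.Balaban1983to89
open MatrixLog ExpMeanLog
open Literature.MathematicalPhysics.QuantumFieldTheory.Balaban1983to89.BlockAveragingEMLProp2 (norm_eml_sub_one_sub_mean_le)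
open Literature.Analysis.Complex (logOnePlus)
open Literature.Analysis.Calculus.BCH (bch3 norm_logOnePlus_sub_bch3_le_mul_sixth exp_quarter_le)

variable {𝔸 : Type*} [NormedRing 𝔸] [NormedAlgebra ℂ 𝔸] [CompleteSpace 𝔸] [NormOneClass 𝔸]
/-! ## §1  One pair: `log(P·T)` against `bch3 (log P) (log T)` -/
omit [NormOneClass 𝔸] in
/-- For `‖P − 1‖ ≤ p ≤ 1∕24`, `‖T − 1‖ ≤ t ≤ 1∕24`: `‖log(P·T) − bch3 (log P) (log T)‖ ≤ 207360·p·(p+t)³` (`log P`, `log T` have norms `≤ 2p`, `2t`, sum `≤ 1∕6`).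
[cite: Balaban1987RG1, (0.8) p.253] -/
theorem norm_mlog_mul_sub_bch3_le {P T : 𝔸} {p t : ℝ} (hP : ‖P - 1‖ ≤ p) (hT : ‖T - 1‖ ≤ t) (hp : p ≤ 1 / 24) (ht : t ≤ 1 / 24) :
    ‖mlog (P * T) - bch3 (mlog P) (mlog T)‖ ≤ 207360 * p * (p + t) ^ 3 := by
  have hp0 : 0 ≤ p := (norm_nonneg _).trans hP
  have ht0 : 0 ≤ t := (norm_nonneg _).trans hT
  have hW : ‖mlog P‖ ≤ 2 * p := (norm_mlog_le_two_mul (hP.trans (by linarith))).trans (by linarith)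
  have hX : ‖mlog T‖ ≤ 2 * t := (norm_mlog_le_two_mul (hT.trans (by linarith))).trans (by linarith)
  have hsum : ‖mlog P‖ + ‖mlog T‖ ≤ 1 / 6 := by linarith
  have heP : exp (mlog P) = P := exp_mlog (lt_of_le_of_lt hP (by linarith))
  have heT : exp (mlog T) = T := exp_mlog (lt_of_le_of_lt hT (by linarith))
  have key := norm_logOnePlus_sub_bch3_le_mul_sixth (mlog P) (mlog T) hsum
  rw [heP, heT, ← mlog_def] at key
  refine key.trans ?_
  have h1 : ‖mlog P‖ + ‖mlog T‖ ≤ 2 * (p + t) := by linarith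
  have h0 : 0 ≤ ‖mlog P‖ + ‖mlog T‖ := by positivity
  calc 12960 * ‖mlog P‖ * (‖mlog P‖ + ‖mlog T‖) ^ 3 ≤ 12960 * (2 * p) * (2 * (p + t)) ^ 3 := by gcongr
    _ = 207360 * p * (p + t) ^ 3 := by ring
/-! ## §2  The σ-sum of `bch3` with a centred first argument -/
omit [NormedAlgebra ℂ 𝔸] [CompleteSpace 𝔸] [NormOneClass 𝔸] in
/-- The `[W,[W,X]]` word of `bch3 W X` (the only word of degree `≤ 3` that is neither `X` nor linear in `W`). [cite: Balaban1987RG1, (0.8) p.253] -/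
theorem norm_cubic_le (W X : 𝔸) : ‖W * (W * X - X * W) - (W * X - X * W) * W‖ ≤ 4 * ‖W‖ ^ 2 * ‖X‖ := by
  have hc : ‖W * X - X * W‖ ≤ 2 * ‖W‖ * ‖X‖ := by
    calc ‖W * X - X * W‖ ≤ ‖W * X‖ + ‖X * W‖ := norm_sub_le _ _
      _ ≤ ‖W‖ * ‖X‖ + ‖X‖ * ‖W‖ := add_le_add (norm_mul_le _ _) (norm_mul_le _ _)
      _ = 2 * ‖W‖ * ‖X‖ := by ring
  calc ‖W * (W * X - X * W) - (W * X - X * W) * W‖ ≤ ‖W * (W * X - X * W)‖ + ‖(W * X - X * W) * W‖ := norm_sub_le _ _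
    _ ≤ ‖W‖ * ‖W * X - X * W‖ + ‖W * X - X * W‖ * ‖W‖ := add_le_add (norm_mul_le _ _) (norm_mul_le _ _)
    _ ≤ ‖W‖ * (2 * ‖W‖ * ‖X‖) + 2 * ‖W‖ * ‖X‖ * ‖W‖ := by gcongr
    _ = 4 * ‖W‖ ^ 2 * ‖X‖ := by ring

omit [NormedAlgebra ℂ 𝔸] [CompleteSpace 𝔸] [NormOneClass 𝔸] in
/-- A commutator with a centred family sums to zero. [folklore] -/
theorem sum_comm_eq_zero_of_centred {S : Type*} [Fintype S] {W : S → 𝔸} (h0 : ∑ s, W s = 0) (X : 𝔸) :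
    ∑ s, (W s * X - X * W s) = 0 := by
  rw [Finset.sum_sub_distrib, ← Finset.sum_mul, ← Finset.mul_sum, h0, zero_mul, mul_zero, sub_zero]

omit [NormedAlgebra ℂ 𝔸] [CompleteSpace 𝔸] [NormOneClass 𝔸] in
/-- The `[X,[X,W]]` word is linear in `W`, so it sums to zero over a centred family. [folklore] -/
theorem sum_cubicX_eq_zero_of_centred {S : Type*} [Fintype S] {W : S → 𝔸} (h0 : ∑ s, W s = 0) (X : 𝔸) :
    ∑ s, (X * (X * W s - W s * X) - (X * W s - W s * X) * X) = 0 := by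
  have h1 : ∑ s, (X * W s - W s * X) = 0 := by
    rw [Finset.sum_sub_distrib, ← Finset.mul_sum, ← Finset.sum_mul, h0, zero_mul, mul_zero, sub_zero]
  rw [Finset.sum_sub_distrib, ← Finset.mul_sum, ← Finset.sum_mul, h1, mul_zero, zero_mul, sub_zero]

omit [CompleteSpace 𝔸] [NormOneClass 𝔸] in
/-- ★ `Σ_s bch3 W_s X = |S|•X + (1∕12)•Σ_s [W_s,[W_s,X]]` for a centred family `Σ_s W_s = 0`: the words `W`, `½[W,X]`, `(1∕12)[X,[X,W]]` are linear in `W` and die in the sum.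
[cite: Balaban1987RG1, (0.8) p.253] -/
theorem sum_bch3_eq_of_centred {S : Type*} [Fintype S] {W : S → 𝔸} (h0 : ∑ s, W s = 0) (X : 𝔸) :
    ∑ s, bch3 (W s) X = Fintype.card S • X + (12 : ℂ)⁻¹ • ∑ s, (W s * (W s * X - X * W s) - (W s * X - X * W s) * W s) := by
  have hexp : ∀ s, bch3 (W s) X = W s + X + (2 : ℂ)⁻¹ • (W s * X - X * W s) +
      ((12 : ℂ)⁻¹ • (W s * (W s * X - X * W s) - (W s * X - X * W s) * W s) +
        (12 : ℂ)⁻¹ • (X * (X * W s - W s * X) - (X * W s - W s * X) * X)) := by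
    intro s
    rw [← smul_add]
    rfl
  simp only [hexp, Finset.sum_add_distrib, ← Finset.smul_sum, h0, sum_comm_eq_zero_of_centred h0, sum_cubicX_eq_zero_of_centred h0,
    smul_zero, zero_add, add_zero, Finset.sum_const, Finset.card_univ]
/-! ## §3  The `eml` comparison -/
/-- ★★ **(G1)** — for a product family `(r,s) ↦ P r s · T r` whose left factor is log-centred in `s` (`Σ_s log (P r s) = 0` for every `r`), with `‖P r s − 1‖ ≤ p ≤ 1∕24`,
`‖T r − 1‖ ≤ t ≤ 1∕24`: `‖eml(P·T) − eml(T)‖ ≤ 270000·p·(p+t)³ + 4·p²·t` — third order (every term carries a `p`; the only cubic word is `(1∕12)[log P,[log P, log T]]`).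
[cite: Balaban1987RG1, (0.8) p.253; Balaban1985Averaging, (97) p.32] -/
theorem norm_eml_centred_mul_sub_eml_le {R S : Type*} [Fintype R] [Fintype S] [Nonempty R] [Nonempty S]
    {P : R → S → 𝔸} {T : R → 𝔸} {p t : ℝ} (hP : ∀ r s, ‖P r s - 1‖ ≤ p) (hT : ∀ r, ‖T r - 1‖ ≤ t) (hp : p ≤ 1 / 24) (ht : t ≤ 1 / 24)
    (h0 : ∀ r, ∑ s, mlog (P r s) = 0) :
    ‖eml (fun rs : R × S => P rs.1 rs.2 * T rs.1) - eml T‖ ≤ 270000 * p * (p + t) ^ 3 + 4 * p ^ 2 * t := by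
  obtain ⟨r₀⟩ := ‹Nonempty R›
  have hp0 : 0 ≤ p := (norm_nonneg _).trans (hP r₀ (Classical.arbitrary S))
  have ht0 : 0 ≤ t := (norm_nonneg _).trans (hT r₀)
  -- names
  set W : R → S → 𝔸 := fun r s => mlog (P r s) with hWdef
  set X : R → 𝔸 := fun r => mlog (T r) with hXdef
  set E : ℝ := 207360 * p * (p + t) ^ 3 + 8 / 3 * p ^ 2 * t with hEdef
  -- the per-pair remainder `g r s := log(P T) − X − (words linear in W)`
  set lin : R → S → 𝔸 := fun r s => W r s + (2 : ℂ)⁻¹ • (W r s * X r - X r * W r s) +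
      (12 : ℂ)⁻¹ • (X r * (X r * W r s - W r s * X r) - (X r * W r s - W r s * X r) * X r) with hlindef
  set g : R → S → 𝔸 := fun r s => mlog (P r s * T r) - X r - lin r s with hgdef
  have hWn : ∀ r s, ‖W r s‖ ≤ 2 * p := fun r s => (norm_mlog_le_two_mul ((hP r s).trans (by linarith))).trans (by linarith [hP r s])
  have hXn : ∀ r, ‖X r‖ ≤ 2 * t := fun r => (norm_mlog_le_two_mul ((hT r).trans (by linarith))).trans (by linarith [hT r])
  -- `g = (log(PT) − bch3) + (1/12)[W,[W,X]]`
  have hg_eq : ∀ r s, g r s = (mlog (P r s * T r) - bch3 (W r s) (X r)) +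
      (12 : ℂ)⁻¹ • (W r s * (W r s * X r - X r * W r s) - (W r s * X r - X r * W r s) * W r s) := by
    intro r s
    simp only [hgdef, hlindef, bch3, smul_add]
    abel
  have hg : ∀ r s, ‖g r s‖ ≤ E := by
    intro r s
    rw [hg_eq]
    refine (norm_add_le _ _).trans ?_
    have h1 := norm_mlog_mul_sub_bch3_le (hP r s) (hT r) hp ht
    have h2 : ‖(12 : ℂ)⁻¹ • (W r s * (W r s * X r - X r * W r s) - (W r s * X r - X r * W r s) * W r s)‖ ≤ 8 / 3 * p ^ 2 * t := by
      rw [norm_smul, norm_inv, show ‖(12 : ℂ)‖ = 12 by simp]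
      have h3 := norm_cubic_le (W r s) (X r)
      have h4 : 4 * ‖W r s‖ ^ 2 * ‖X r‖ ≤ 4 * (2 * p) ^ 2 * (2 * t) := by
        have := hWn r s; have := hXn r; have : 0 ≤ ‖W r s‖ := norm_nonneg _; gcongr
      calc (12 : ℝ)⁻¹ * ‖W r s * (W r s * X r - X r * W r s) - (W r s * X r - X r * W r s) * W r s‖ ≤ 12⁻¹ * (4 * (2 * p) ^ 2 * (2 * t)) := by
            gcongr; exact h3.trans h4
        _ = 8 / 3 * p ^ 2 * t := by ring
    rw [hEdef]
    exact add_le_add h1 h2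
  -- the linear words die in the `s`-sum
  have h0W : ∀ r, ∑ s, W r s = 0 := fun r => by simp only [hWdef]; exact h0 r
  have hlin : ∀ r, ∑ s, lin r s = 0 := by
    intro r
    simp only [hlindef, Finset.sum_add_distrib, ← Finset.smul_sum, h0W r, sum_comm_eq_zero_of_centred (h0W r), sum_cubicX_eq_zero_of_centred (h0W r),
      smul_zero, add_zero]
  -- the two exponents
  set ZV : 𝔸 := ((Fintype.card (R × S) : ℂ))⁻¹ • ∑ rs : R × S, mlog (P rs.1 rs.2 * T rs.1) with hZVdef
  set ZS : 𝔸 := ((Fintype.card R : ℂ))⁻¹ • ∑ r, mlog (T r) with hZSdef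
  have hV : eml (fun rs : R × S => P rs.1 rs.2 * T rs.1) = exp ZV := eml_eq_exp _
  have hS : eml T = exp ZS := eml_eq_exp _
  have hR0 : (Fintype.card R : ℂ) ≠ 0 := Nat.cast_ne_zero.2 Fintype.card_ne_zero
  have hS0 : (Fintype.card S : ℂ) ≠ 0 := Nat.cast_ne_zero.2 Fintype.card_ne_zero
  -- `ZV − ZS = mean of g`
  have hdiff : ZV - ZS = ((Fintype.card (R × S) : ℂ))⁻¹ • ∑ rs : R × S, g rs.1 rs.2 := by
    have hsum : ∑ rs : R × S, mlog (P rs.1 rs.2 * T rs.1) = Fintype.card S • ∑ r, X r + ∑ rs : R × S, g rs.1 rs.2 := by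
      rw [Fintype.sum_prod_type, Fintype.sum_prod_type]
      have hpt : ∀ r, ∑ s, mlog (P r s * T r) = Fintype.card S • X r + ∑ s, g r s := by
        intro r
        have : ∀ s, mlog (P r s * T r) = X r + lin r s + g r s := fun s => by simp only [hgdef]; abel
        simp only [this, Finset.sum_add_distrib, hlin r, add_zero, Finset.sum_const, Finset.card_univ]
      simp only [hpt, Finset.sum_add_distrib, Finset.smul_sum]
    rw [hZVdef, hZSdef, hsum, smul_add, Fintype.card_prod, Nat.cast_mul, mul_inv, ← Nat.cast_smul_eq_nsmul ℂ, smul_smul,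
      mul_assoc, inv_mul_cancel₀ hS0, mul_one]
    abel
  have hnorm_diff : ‖ZV - ZS‖ ≤ E := by
    rw [hdiff, norm_smul, norm_inv, Complex.norm_natCast, Fintype.card_prod, Nat.cast_mul]
    have hcard : (0 : ℝ) < (Fintype.card R : ℝ) * (Fintype.card S : ℝ) := by positivity
    rw [inv_mul_le_iff₀ hcard]
    calc ‖∑ rs : R × S, g rs.1 rs.2‖ ≤ ∑ rs : R × S, ‖g rs.1 rs.2‖ := norm_sum_le _ _
      _ ≤ ∑ _rs : R × S, E := Finset.sum_le_sum fun rs _ => hg rs.1 rs.2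
      _ = (Fintype.card R : ℝ) * (Fintype.card S : ℝ) * E := by
          rw [Finset.sum_const, Finset.card_univ, Fintype.card_prod, nsmul_eq_mul, Nat.cast_mul]
  -- sizes of the exponents
  have hZS : ‖ZS‖ ≤ 1 / 4 := by
    rw [hZSdef, norm_smul, norm_inv, Complex.norm_natCast]
    have hcard : (0 : ℝ) < (Fintype.card R : ℝ) := by positivity
    rw [inv_mul_le_iff₀ hcard]
    calc ‖∑ r, mlog (T r)‖ ≤ ∑ r, ‖mlog (T r)‖ := norm_sum_le _ _
      _ ≤ ∑ _r : R, 2 * t := Finset.sum_le_sum fun r _ => hXn r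
      _ = (Fintype.card R : ℝ) * (2 * t) := by rw [Finset.sum_const, Finset.card_univ, nsmul_eq_mul]
      _ ≤ (Fintype.card R : ℝ) * (1 / 4) := by gcongr; linarith
  have hPT : ∀ r s, ‖P r s * T r - 1‖ ≤ 1 / 8 := by
    intro r s
    have h1 : P r s * T r - 1 = P r s * (T r - 1) + (P r s - 1) := by noncomm_ring
    have hPn : ‖P r s‖ ≤ 1 + p := by
      calc ‖P r s‖ = ‖(P r s - 1) + 1‖ := by rw [sub_add_cancel]
        _ ≤ ‖P r s - 1‖ + ‖(1 : 𝔸)‖ := norm_add_le _ _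
        _ ≤ p + 1 := by rw [norm_one]; linarith [hP r s]
        _ = 1 + p := by ring
    rw [h1]
    calc ‖P r s * (T r - 1) + (P r s - 1)‖ ≤ ‖P r s‖ * ‖T r - 1‖ + ‖P r s - 1‖ := (norm_add_le _ _).trans (add_le_add (norm_mul_le _ _) le_rfl)
      _ ≤ (1 + p) * t + p := by gcongr; exact hT r; exact hP r s
      _ ≤ 1 / 8 := by nlinarith
  have hZV : ‖ZV‖ ≤ 1 / 4 := by
    rw [hZVdef, norm_smul, norm_inv, Complex.norm_natCast]
    have hcard : (0 : ℝ) < (Fintype.card (R × S) : ℝ) := by positivity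
    rw [inv_mul_le_iff₀ hcard]
    calc ‖∑ rs : R × S, mlog (P rs.1 rs.2 * T rs.1)‖ ≤ ∑ rs : R × S, ‖mlog (P rs.1 rs.2 * T rs.1)‖ := norm_sum_le _ _
      _ ≤ ∑ _rs : R × S, (1 / 4 : ℝ) := Finset.sum_le_sum fun rs _ =>
          (norm_mlog_le_two_mul ((hPT rs.1 rs.2).trans (by norm_num))).trans (by linarith [hPT rs.1 rs.2])
      _ = (Fintype.card (R × S) : ℝ) * (1 / 4) := by rw [Finset.sum_const, Finset.card_univ, nsmul_eq_mul]
  -- `exp` is Lipschitz on the ball of radius `1/4`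
  rw [hV, hS]
  have hexp := Literature.Analysis.Complex.norm_exp_sub_exp_le ZV ZS
  have hmax : Real.exp (max ‖ZV‖ ‖ZS‖) ≤ 1.3 := (Real.exp_le_exp.2 (max_le hZV hZS)).trans exp_quarter_le
  have hE0 : 0 ≤ E := by rw [hEdef]; positivity
  calc ‖exp ZV - exp ZS‖ ≤ ‖ZV - ZS‖ * Real.exp (max ‖ZV‖ ‖ZS‖) := hexp
    _ ≤ E * 1.3 := by gcongr
    _ ≤ 270000 * p * (p + t) ^ 3 + 4 * p ^ 2 * t := by
        rw [hEdef]
        have h1 : 0 ≤ p * (p + t) ^ 3 := by positivity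
        have h2 : 0 ≤ p ^ 2 * t := by positivity
        nlinarith

/-! ## §4  (G2) The conjugating-frame errors: the centre error cancels at first order, the block-site errors average with coefficient one -/

omit [CompleteSpace 𝔸] [NormOneClass 𝔸] in
/-- ★★ **(G2)** — EXACT IDENTITY behind the first-order cancellation: for `c·a = 1`,
`eml(Y·b·c)·a − eml(Y) = mean_r (Y_r·(b_r − 1)) + (eml(Y b c) − 1 − mean(Y b c − 1))·a − (eml Y − 1 − mean(Y − 1))`
(the centre factor `a` drops out of the first-order part). [cite: Balaban1985Averaging, (97)–(100) p.32] -/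
theorem eml_mul_conj_mul_sub_eml_eq {R : Type*} [Fintype R] [Nonempty R] (Y b : R → 𝔸) {a c : 𝔸} (hca : c * a = 1) :
    eml (fun r => Y r * b r * c) * a - eml Y =
      ((Fintype.card R : ℂ))⁻¹ • ∑ r, Y r * (b r - 1) +
        ((eml (fun r => Y r * b r * c) - 1 - ((Fintype.card R : ℂ))⁻¹ • ∑ r, (Y r * b r * c - 1)) * a -
          (eml Y - 1 - ((Fintype.card R : ℂ))⁻¹ • ∑ r, (Y r - 1))) := by
  have h1 : (((Fintype.card R : ℂ))⁻¹ • ∑ r, (Y r * b r * c - 1)) * a = ((Fintype.card R : ℂ))⁻¹ • ∑ r, (Y r * b r - a) := by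
    rw [smul_mul_assoc, Finset.sum_mul]
    congr 1
    refine Finset.sum_congr rfl fun r _ => ?_
    rw [sub_mul, one_mul, mul_assoc (Y r * b r), hca, mul_one]
  have h2 : ∑ r, (Y r * b r - a) = ∑ r, Y r * (b r - 1) + ∑ r, (Y r - 1) - ∑ _r : R, (a - 1) := by
    rw [← Finset.sum_add_distrib, ← Finset.sum_sub_distrib]
    refine Finset.sum_congr rfl fun r _ => ?_
    noncomm_ring
  have hR : (Fintype.card R : ℂ) ≠ 0 := Nat.cast_ne_zero.2 Fintype.card_ne_zero
  rw [sub_mul, sub_mul, one_mul, h1, h2, Finset.sum_const, Finset.card_univ, smul_sub, smul_add, ← Nat.cast_smul_eq_nsmul ℂ, smul_smul,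
    inv_mul_cancel₀ hR, one_smul]
  abel

/-- ★★ **(G2), the estimate**: `‖Y_r − 1‖ ≤ t`, `‖b_r − 1‖ ≤ φ`, `‖a − 1‖ ≤ φ`, `‖c − 1‖ ≤ φ`, `c·a = 1`, `t, φ ≤ 1∕24` ⇒
`‖eml(Y·b·c)·a − eml Y‖ ≤ φ + 64·(t+φ)²` — coefficient ONE on the block-site error `φ`, the centre error only at second order.
[cite: Balaban1985Averaging, (97)–(100) p.32, (26)–(27) p.22] -/
theorem norm_eml_mul_conj_mul_sub_eml_le {R : Type*} [Fintype R] [Nonempty R] {Y b : R → 𝔸} {a c : 𝔸} {t φ : ℝ} (hca : c * a = 1)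
    (hY : ∀ r, ‖Y r - 1‖ ≤ t) (hb : ∀ r, ‖b r - 1‖ ≤ φ) (ha : ‖a - 1‖ ≤ φ) (hc : ‖c - 1‖ ≤ φ) (ht : t ≤ 1 / 24) (hφ : φ ≤ 1 / 24) :
    ‖eml (fun r => Y r * b r * c) * a - eml Y‖ ≤ φ + 64 * (t + φ) ^ 2 := by
  have ht0 : 0 ≤ t := (norm_nonneg _).trans (hY (Classical.arbitrary R))
  have hφ0 : 0 ≤ φ := (norm_nonneg _).trans ha
  have hnY : ∀ r, ‖Y r‖ ≤ 1 + t := fun r => by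
    calc ‖Y r‖ = ‖(Y r - 1) + 1‖ := by rw [sub_add_cancel]
      _ ≤ ‖Y r - 1‖ + ‖(1 : 𝔸)‖ := norm_add_le _ _
      _ ≤ t + 1 := by rw [norm_one]; linarith [hY r]
      _ = 1 + t := by ring
  have hnb : ∀ r, ‖b r‖ ≤ 1 + φ := fun r => by
    calc ‖b r‖ = ‖(b r - 1) + 1‖ := by rw [sub_add_cancel]
      _ ≤ ‖b r - 1‖ + ‖(1 : 𝔸)‖ := norm_add_le _ _
      _ ≤ φ + 1 := by rw [norm_one]; linarith [hb r]
      _ = 1 + φ := by ring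
  have hna : ‖a‖ ≤ 1 + φ := by
    calc ‖a‖ = ‖(a - 1) + 1‖ := by rw [sub_add_cancel]
      _ ≤ ‖a - 1‖ + ‖(1 : 𝔸)‖ := norm_add_le _ _
      _ ≤ φ + 1 := by rw [norm_one]; linarith
      _ = 1 + φ := by ring
  -- size of the conjugated family
  have hZ : ∀ r, ‖Y r * b r * c - 1‖ ≤ 2 * t + 3 * φ := by
    intro r
    have h1 : Y r * b r * c - 1 = (Y r - 1) * b r * c + (b r - 1) * c + (c - 1) := by noncomm_ring
    rw [h1]
    have hnc : ‖c‖ ≤ 1 + φ := by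
      calc ‖c‖ = ‖(c - 1) + 1‖ := by rw [sub_add_cancel]
        _ ≤ ‖c - 1‖ + ‖(1 : 𝔸)‖ := norm_add_le _ _
        _ ≤ φ + 1 := by rw [norm_one]; linarith
        _ = 1 + φ := by ring
    calc ‖(Y r - 1) * b r * c + (b r - 1) * c + (c - 1)‖ ≤ ‖(Y r - 1) * b r * c‖ + ‖(b r - 1) * c‖ + ‖c - 1‖ := norm_add₃_le
      _ ≤ ‖Y r - 1‖ * ‖b r‖ * ‖c‖ + ‖b r - 1‖ * ‖c‖ + ‖c - 1‖ := by
          gcongr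
          · exact (norm_mul_le _ _).trans (mul_le_mul_of_nonneg_right (norm_mul_le _ _) (norm_nonneg _))
          · exact norm_mul_le _ _
      _ ≤ t * (1 + φ) * (1 + φ) + φ * (1 + φ) + φ := by
          have := hY r; have := hb r; have := hnb r
          gcongr
      _ ≤ 2 * t + 3 * φ := by
          have e1 : t * φ ≤ t * (1 / 24) := mul_le_mul_of_nonneg_left hφ ht0
          have e2 : φ * φ ≤ φ * (1 / 24) := mul_le_mul_of_nonneg_left hφ hφ0
          have e3 : t * φ * φ ≤ t * (1 / 24) * φ := mul_le_mul_of_nonneg_right e1 hφ0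
          nlinarith [mul_nonneg ht0 hφ0]
  have hz4 : 2 * t + 3 * φ ≤ 1 / 4 := by linarith
  have hE1 := norm_eml_sub_one_sub_mean_le (W := fun r => Y r * b r * c) hZ hz4
  have hE2 := norm_eml_sub_one_sub_mean_le hY (ht.trans (by norm_num))
  rw [eml_mul_conj_mul_sub_eml_eq Y b hca]
  have hmean : ‖((Fintype.card R : ℂ))⁻¹ • ∑ r, Y r * (b r - 1)‖ ≤ (1 + t) * φ := by
    rw [norm_smul, norm_inv, Complex.norm_natCast]
    have hcard : (0 : ℝ) < (Fintype.card R : ℝ) := by positivity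
    rw [inv_mul_le_iff₀ hcard]
    calc ‖∑ r, Y r * (b r - 1)‖ ≤ ∑ r, ‖Y r * (b r - 1)‖ := norm_sum_le _ _
      _ ≤ ∑ _r : R, (1 + t) * φ := Finset.sum_le_sum fun r _ => (norm_mul_le _ _).trans (by
          have := hnY r; have := hb r; gcongr)
      _ = (Fintype.card R : ℝ) * ((1 + t) * φ) := by rw [Finset.sum_const, Finset.card_univ, nsmul_eq_mul]
  calc ‖((Fintype.card R : ℂ))⁻¹ • ∑ r, Y r * (b r - 1) +
        ((eml (fun r => Y r * b r * c) - 1 - ((Fintype.card R : ℂ))⁻¹ • ∑ r, (Y r * b r * c - 1)) * a -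
          (eml Y - 1 - ((Fintype.card R : ℂ))⁻¹ • ∑ r, (Y r - 1)))‖
      ≤ ‖((Fintype.card R : ℂ))⁻¹ • ∑ r, Y r * (b r - 1)‖ +
        (‖(eml (fun r => Y r * b r * c) - 1 - ((Fintype.card R : ℂ))⁻¹ • ∑ r, (Y r * b r * c - 1)) * a‖ +
          ‖eml Y - 1 - ((Fintype.card R : ℂ))⁻¹ • ∑ r, (Y r - 1)‖) := (norm_add_le _ _).trans (add_le_add le_rfl (norm_sub_le _ _))
    _ ≤ (1 + t) * φ + (6 * (2 * t + 3 * φ) ^ 2 * (1 + φ) + 6 * t ^ 2) :=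
        add_le_add hmean (add_le_add ((norm_mul_le _ _).trans (mul_le_mul hE1 hna (norm_nonneg _) (by positivity))) hE2)
    _ ≤ φ + 64 * (t + φ) ^ 2 := by
        have e1 : t * φ ≤ t * (1 / 24) := mul_le_mul_of_nonneg_left hφ ht0
        have e2 : t * t * φ ≤ t * t * (1 / 24) := mul_le_mul_of_nonneg_left hφ (mul_nonneg ht0 ht0)
        have e3 : t * φ * φ ≤ t * φ * (1 / 24) := mul_le_mul_of_nonneg_left hφ (mul_nonneg ht0 hφ0)
        have e4 : φ * φ * φ ≤ φ * φ * (1 / 24) := mul_le_mul_of_nonneg_left hφ (mul_nonneg hφ0 hφ0)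
        nlinarith [mul_nonneg ht0 hφ0, mul_nonneg hφ0 hφ0, mul_nonneg ht0 ht0]

/-! ## §5  (G3a) One frame step, algebra only: UST's `a·eml_{(r,s)}[c·P̂_{rs}·Y_r·b_r]` against print's `eml_r[Y_r]` -/

/-- ★★★ **(G3a) — THE ONE-STEP FRAME COMPARISON, ALGEBRAIC FORM.**  Centre frames `a = S(ȳ)⁻¹V(ȳ)`, `c = a⁻¹` (`c·a = a·c = 1`, `‖a−1‖, ‖c−1‖ ≤ φ`), block-site frames
`b_r = S(x_r)⁻¹V(x_r)` (`‖b_r − 1‖ ≤ φ`), print's sheared family `Y_r = S(ȳ)⁻¹F_rS(x_r)` (`‖Y_r − 1‖ ≤ t`), and the log-centred relative stair family `P̂_{rs}` (`Σ_s log P̂_{rs} = 0`,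
`‖P̂_{rs} − 1‖ ≤ p`), with `p ≤ 1∕24`, `2t + 3φ ≤ 1∕24`: then
`‖a·eml((r,s) ↦ c·(P̂_{rs}·(Y_r·b_r))) − eml Y‖ ≤ φ + 64(t+φ)² + (1+φ)·(270000·p·(p+2t+3φ)³ + 4·p²·(2t+3φ))`
— the UST frame step divided by `S(ȳ)` against print's (85) step divided by `S(ȳ)`: coefficient ONE on `φ`, everything else second∕third order.
[cite: Balaban1985Averaging, (85) p.31, (97)–(100) p.32, (110) p.34; Balaban1987RG1, (0.8)–(0.11) p.253] -/
theorem norm_frameStep_sub_eml_le {R S : Type*} [Fintype R] [Fintype S] [Nonempty R] [Nonempty S]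
    {Ph : R → S → 𝔸} {Y b : R → 𝔸} {a c : 𝔸} {p t φ : ℝ} (hca : c * a = 1) (hac : a * c = 1)
    (hPh : ∀ r s, ‖Ph r s - 1‖ ≤ p) (h0 : ∀ r, ∑ s, mlog (Ph r s) = 0) (hY : ∀ r, ‖Y r - 1‖ ≤ t) (hb : ∀ r, ‖b r - 1‖ ≤ φ)
    (ha : ‖a - 1‖ ≤ φ) (hc : ‖c - 1‖ ≤ φ) (hp : p ≤ 1 / 24) (htφ : 2 * t + 3 * φ ≤ 1 / 24) :
    ‖a * eml (fun rs : R × S => c * (Ph rs.1 rs.2 * (Y rs.1 * b rs.1))) - eml Y‖ ≤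
      φ + 64 * (t + φ) ^ 2 + (1 + φ) * (270000 * p * (p + (2 * t + 3 * φ)) ^ 3 + 4 * p ^ 2 * (2 * t + 3 * φ)) := by
  have ht0 : 0 ≤ t := (norm_nonneg _).trans (hY (Classical.arbitrary R))
  have hφ0 : 0 ≤ φ := (norm_nonneg _).trans ha
  have ht : t ≤ 1 / 24 := by linarith
  have hφ : φ ≤ 1 / 24 := by linarith
  -- the right factors `T_r = Y_r b_r c`
  set T : R → 𝔸 := fun r => Y r * b r * c with hTdef
  have hT : ∀ r, ‖T r - 1‖ ≤ 2 * t + 3 * φ := by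
    intro r
    have hnb : ‖b r‖ ≤ 1 + φ := by
      calc ‖b r‖ = ‖(b r - 1) + 1‖ := by rw [sub_add_cancel]
        _ ≤ ‖b r - 1‖ + ‖(1 : 𝔸)‖ := norm_add_le _ _
        _ ≤ φ + 1 := by rw [norm_one]; linarith [hb r]
        _ = 1 + φ := by ring
    have hnc : ‖c‖ ≤ 1 + φ := by
      calc ‖c‖ = ‖(c - 1) + 1‖ := by rw [sub_add_cancel]
        _ ≤ ‖c - 1‖ + ‖(1 : 𝔸)‖ := norm_add_le _ _
        _ ≤ φ + 1 := by rw [norm_one]; linarith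
        _ = 1 + φ := by ring
    have h1 : T r - 1 = (Y r - 1) * b r * c + (b r - 1) * c + (c - 1) := by simp only [hTdef]; noncomm_ring
    rw [h1]
    calc ‖(Y r - 1) * b r * c + (b r - 1) * c + (c - 1)‖ ≤ ‖(Y r - 1) * b r * c‖ + ‖(b r - 1) * c‖ + ‖c - 1‖ := norm_add₃_le
      _ ≤ ‖Y r - 1‖ * ‖b r‖ * ‖c‖ + ‖b r - 1‖ * ‖c‖ + ‖c - 1‖ := by
          gcongr
          · exact (norm_mul_le _ _).trans (mul_le_mul_of_nonneg_right (norm_mul_le _ _) (norm_nonneg _))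
          · exact norm_mul_le _ _
      _ ≤ t * (1 + φ) * (1 + φ) + φ * (1 + φ) + φ := by
          have := hY r; have := hb r
          gcongr
      _ ≤ 2 * t + 3 * φ := by
          have e1 : t * φ ≤ t * (1 / 24) := mul_le_mul_of_nonneg_left hφ ht0
          have e2 : φ * φ ≤ φ * (1 / 24) := mul_le_mul_of_nonneg_left hφ hφ0
          have e3 : t * φ * φ ≤ t * (1 / 24) * φ := mul_le_mul_of_nonneg_right e1 hφ0
          nlinarith [mul_nonneg ht0 hφ0]
  -- pull the conjugation `c … a` out of the joint `eml`
  have hfam : (fun rs : R × S => c * (Ph rs.1 rs.2 * (Y rs.1 * b rs.1))) = fun rs : R × S => c * (Ph rs.1 rs.2 * T rs.1) * a := by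
    funext rs
    simp only [hTdef]
    rw [show c * (Ph rs.1 rs.2 * (Y rs.1 * b rs.1 * c)) * a = c * (Ph rs.1 rs.2 * (Y rs.1 * b rs.1)) * (c * a) by noncomm_ring, hca, mul_one]
  have hconj : a * eml (fun rs : R × S => c * (Ph rs.1 rs.2 * (Y rs.1 * b rs.1))) = eml (fun rs : R × S => Ph rs.1 rs.2 * T rs.1) * a := by
    rw [hfam, eml_conj hca hac, ← mul_assoc, ← mul_assoc, hac, one_mul]
  rw [hconj]
  have hna : ‖a‖ ≤ 1 + φ := by
    calc ‖a‖ = ‖(a - 1) + 1‖ := by rw [sub_add_cancel]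
      _ ≤ ‖a - 1‖ + ‖(1 : 𝔸)‖ := norm_add_le _ _
      _ ≤ φ + 1 := by rw [norm_one]; linarith
      _ = 1 + φ := by ring
  have hG1 := norm_eml_centred_mul_sub_eml_le (P := Ph) (T := T) hPh hT hp htφ h0
  have hG2 := norm_eml_mul_conj_mul_sub_eml_le (Y := Y) (b := b) hca hY hb ha hc ht hφ
  have hsplit : eml (fun rs : R × S => Ph rs.1 rs.2 * T rs.1) * a - eml Y =
      (eml (fun rs : R × S => Ph rs.1 rs.2 * T rs.1) - eml T) * a + (eml (fun r => Y r * b r * c) * a - eml Y) := by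
    simp only [hTdef]; noncomm_ring
  rw [hsplit]
  have hp0 : 0 ≤ p := (norm_nonneg _).trans (hPh (Classical.arbitrary R) (Classical.arbitrary S))
  calc ‖(eml (fun rs : R × S => Ph rs.1 rs.2 * T rs.1) - eml T) * a + (eml (fun r => Y r * b r * c) * a - eml Y)‖
      ≤ ‖eml (fun rs : R × S => Ph rs.1 rs.2 * T rs.1) - eml T‖ * ‖a‖ + ‖eml (fun r => Y r * b r * c) * a - eml Y‖ :=
        (norm_add_le _ _).trans (add_le_add (norm_mul_le _ _) le_rfl)
    _ ≤ (270000 * p * (p + (2 * t + 3 * φ)) ^ 3 + 4 * p ^ 2 * (2 * t + 3 * φ)) * (1 + φ) + (φ + 64 * (t + φ) ^ 2) :=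
        add_le_add (mul_le_mul hG1 hna (norm_nonneg _) (by positivity)) hG2
    _ = φ + 64 * (t + φ) ^ 2 + (1 + φ) * (270000 * p * (p + (2 * t + 3 * φ)) ^ 3 + 4 * p ^ 2 * (2 * t + 3 * φ)) := by ring

end Summit.QuantumFields.YangMills.BalabanUVNodes.N07EmlCentredProduct

end
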